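import Summits.HodgeConjecture.HodgeConjecture.Theorems.H413ThetaDistDescent
import HarnessLib

/-!
# FLOOR-0 P4, seat S4′(i) — `HolReal` FROM A TRANSPORT: the stub's conclusion for ANY carrier identified, equivariantly up to a character,
# with a twist of the model's coinvariants (the CAPSTONE SKELETON of seat (i): what LT + the junction knob must deliver, by name)

Cell hodgecm-mathlib (D-0151), FLOOR 0, crux item H413 = stmt-HodgeConjecture-24833; programme P4, line
`Cruxes/H413/Lines/F0_P4AdmissibleOccursInH1.lean`, stub S4′ `stub_T3a_holThetaRealisationOfRallisAt` (node `StubT3aHolThetaRealisationAt`: for each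
admissible weight-one `t` of the holomorphic class, `∃ θ : ω_V(t) →ₗ (Adelic → ℂ²), θ ≠ 0 ∧ (∀ v, θ v ∈ holCotForms 𝔞₀) ∧ ∀ g v, θ (ρ_t g v) = rightRep g (θ v)`).
Author F0P4-p01 (g0) (seat (i)); SEAT-i MEMO v2 §5 (J-f)∕(J-g).  `--supports stmt-HodgeConjecture-24833 --as helper`.  DEF-FREE.

**`exists_holReal_of_transport`.**  Let `D` be a product theta-distribution datum of the model over a side `S` with `S.ιinf = archInfOf V`,
`(S.P k).ΓU = Γ`, `sat(K) ≤ S.Gfin` (★ `Theorems/H413ThetaDistAtLine.sideAt`), with the analytic inputs `hLF hd hCR`, and `χ̃` a character of `[E¹]`.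
Let `(Ω, ρ)` be ANY `ℂ[U(V)(𝔸_f)]`-module (the pin's `ω_V(t)` with `rhoTriple t`) and `(S₁, ρV₁, ρW₁, χ₁)` ANY commuting pair on a `ℂ`-space with a character
of the model's finite torus `D.Uf` (the target of the line transport LT at the model's W-spelling: `finPairRep[diag dV, diagonal (lineVec a_e), s′]`,
A-p17 (g12)), together with
* `Ψ : Ω ≃ₗ[ℂ] Coinv ρW₁ χ₁` equivariant UP TO a unit-valued `λ`: `Ψ (ρ g x) = λ g • rep g (Ψ x)` (LT ∘ J-a ∘ J-b: ★ `UnitaryDualPairWeilCoinvariantsReference`,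
  ★ `Theorems/H413FinPairRepGramTransport`),
* a linear equivalence `T : S₁ ≃ₗ[ℂ] 𝒮((𝔸_{L⁺}^∞)³)` (the reindex `finSBReindex e₁`) along which the model's `D.ωf (1,u)` is `ρW₁ u` TWISTED by units `e u` and
  `D.ωf (g,1)` is `ρV₁ g` twisted by THE SAME `λ g` (★ `finRepZero_apply`: `e`, `λ` = the two members of `finCharZero = etaT₀ η ν · cmLineChar₀` — the knob
  `ν` of `sideAt` is what makes the `U(V)`-scalar equal to LT's `λ`), and `D.chiFin χ̃ = e · χ₁` (the (χ) junction, F0P4-p02 brick 6),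
* ONE test function with `D.dist (charInv χ̃) Φ_f ≠ 0` (seat (ii)),
THEN the stub's conclusion holds for `(Ω, ρ)`: `∃ θ : Ω →ₗ[ℂ] ((adelicDatum F V).Adelic → ℂ²), θ ≠ 0 ∧ (∀ v, θ v ∈ holCotForms (archFactorOf F V)) ∧
∀ g v, θ (ρ g v) = rightRep F V g (θ v)` — ON THE NOSE.  Proof: `θ := θ_D ∘ mapEquiv T e ∘ Ψ` with `θ_D` of ★ `Theorems/H413ThetaDistDescent.exists_coinvLift_dist`
(★ `TwistedCoinv.mapEquiv`∕`mapEquiv_rep`); the two `λ`'s cancel.  `exists_holReal_of_transport_sideAt` is the instance over `sideAt`.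

HC_CM is proved only modulo the printed citations until rung 0 closes; this file proves nothing about them.

## References
* [Liu2021] Y. Liu, Camb. J. Math. 9 (2021) = arXiv:2102.11518, proof of Prop. 4.13 (l. 2145), App. D §D.1 Step 3 (l. 5219–5221).
* [GelbartRogawski1991] S. Gelbart, J. Rogawski, Invent. Math. 105 (1991), §3.1 Remark p. 457 L4–13.  [Weil1964] A. Weil, Acta Math. 111 (1964), n° 41.
* Tree: ★ `Literature/RepresentationTheory/TwistedCoinvariants` (`mapEquiv`, `mapEquiv_rep`, `rep`), ★ `Theorems/H413ThetaDistDescent` (`exists_coinvLift_dist`),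
  ★ `Theorems/H413ThetaDistAtLine` (`sideAt`).
-/

set_option autoImplicit false
set_option linter.dupNamespace false

noncomputable section

open MulAction NumberField NumberField.mixedEmbedding IsDedekindDomain
open scoped SchwartzMap TensorProduct Classical
open Literature.NumberTheory.Automorphic Literature.NumberTheory.Automorphic.UnitaryGroup Literature.NumberTheory.Weil1964
open Literature.Geometry.ComplexHyperbolic.BallModel (U21 x₀)
open Literature.AlgebraicGeometry.ShimuraVarieties
open Literature.AlgebraicGeometry.Motives (CMType)
open Literature.NumberTheory.GelbartRogawski1991 Literature.NumberTheory.GelbartRogawski1991.UnitaryDualPair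
open HodgeCM HodgeCM.Adelic HodgeCM.PerL34 HodgeCM.Model HodgeCM.Model.ThetaSpace HodgeCM.Model.ArchSideTerm HodgeCM.Model.ThetaAdelicSide
open HodgeCM.Model.SupplyResidual.WeilPairData (charInv)
open Summit.HodgeConjecture.HodgeConjecture.Cruxes.H413.CohFormsCarriers
open Summit.HodgeConjecture.HodgeConjecture.Cruxes.H413.CuspCot

namespace Summit.HodgeConjecture.HodgeConjecture.Cruxes.H413.ThetaJunction

variable (F : HodgeCM.CMField) {ι₁ : F →+* ℂ} (V : HodgeCM.HermSpace3 F ι₁) (hV : IsAnisotropic F (HodgeCM.HermSpace3.Hm V))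

section Generic

variable {c : SeesawCtx F} {S : ThetaAdelicSide V c} {k : Fin 4} (D : S.ThetaDistDatum hV k)
  (hι : S.ιinf = archInfOf V) (hΓ : (S.P k).ΓU = (V.latticeModel printFact_unitaryCompact_holds).Γ)
  (hGfin : ∀ K : Subgroup ↥(HodgeCM.HermSpace3.adelicFin V), ThetaDistDatum.satG hV K ≤ S.Gfin)
  (hLF : (S.P k).IsLFAction)
  (hd : ∀ (T : 𝓢((Fin 3 → mixedSpace (↥(maximalRealSubfield F))), ℂ) →L[ℂ] ℂ) (ℓ : Module.Dual ℂ (Fin 2 → ℂ)),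
    DifferentiableAt ℝ (fun b => T (D.ωA (BallForms.expP b) (D.Φarch ℓ))) 0)
  (hCR : ∀ (T : 𝓢((Fin 3 → mixedSpace (↥(maximalRealSubfield F))), ℂ) →L[ℂ] ℂ) (ℓ : Module.Dual ℂ (Fin 2 → ℂ)) (v : Fin 2 → ℂ),
    fderiv ℝ (fun b => T (D.ωA (BallForms.expP b) (D.Φarch ℓ))) 0 (Complex.I • v) =
      Complex.I • fderiv ℝ (fun b => T (D.ωA (BallForms.expP b) (D.Φarch ℓ))) 0 v)
  (χ : PontryaginDual (↥(Literature.NumberTheory.Automorphic.relNormOneIdeles (↥(maximalRealSubfield F)) F) ⧸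
      Literature.NumberTheory.Automorphic.relNormOneRat (↥(maximalRealSubfield F)) F))

variable {Ω : Type} [AddCommGroup Ω] [Module ℂ Ω] (ρ : Representation ℂ ↥(HodgeCM.HermSpace3.adelicFin V) Ω)
  {S₁ : Type} [AddCommGroup S₁] [Module ℂ S₁] (ρV₁ : Representation ℂ ↥(HodgeCM.HermSpace3.adelicFin V) S₁)
  (ρW₁ : Representation ℂ D.Uf S₁) (hc₁ : ∀ (g : ↥(HodgeCM.HermSpace3.adelicFin V)) (u : D.Uf), Commute (ρV₁ g) (ρW₁ u))
  (χ₁ : D.Uf →* ℂˣ) (lam : ↥(HodgeCM.HermSpace3.adelicFin V) → ℂˣ)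
  (Ψ : Ω ≃ₗ[ℂ] Literature.RepresentationTheory.TwistedCoinv.Coinv ρW₁ χ₁)
  (hΨ : ∀ (g : ↥(HodgeCM.HermSpace3.adelicFin V)) (x : Ω),
    Ψ (ρ g x) = ((lam g : ℂˣ) : ℂ) • Literature.RepresentationTheory.TwistedCoinv.rep χ₁ ρV₁ hc₁ g (Ψ x))
  (T : S₁ ≃ₗ[ℂ] FinSB (↥(maximalRealSubfield F)) (Fin 3)) (e : D.Uf → ℂˣ)
  (hT : ∀ (u : D.Uf) (v : S₁), D.ωf.comp (MonoidHom.inr _ _) u (T v) = ((e u : ℂˣ) : ℂ) • T (ρW₁ u v))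
  (hχ : ∀ u : D.Uf, D.chiFin χ u = e u * χ₁ u)
  (hTV : ∀ (g : ↥(HodgeCM.HermSpace3.adelicFin V)) (v : S₁), D.ωf.comp (MonoidHom.inl _ _) g (T v) = ((lam g : ℂˣ) : ℂ) • T (ρV₁ g v))
  (hne : ∃ Φf : FinSB (↥(maximalRealSubfield F)) (Fin 3), D.dist (charInv χ) Φf ≠ 0)

set_option maxHeartbeats 400000 in
include hι hΓ hGfin hLF hd hCR hΨ hT hχ hTV hne in
/-- **`HolReal` FROM A TRANSPORT** (the capstone skeleton of seat (i)): see the module docstring.  The `U(V)(𝔸_f)`-scalars `λ` picked up by `Ψ` and by `T`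
cancel, so the equivariance holds ON THE NOSE; non-vanishing is that of the `χ`-component of the distribution.
[cite: Liu2021, proof of Prop. 4.13, l. 2145; App. D §D.1 Step 3 (l. 5219–5221)] [cite: GelbartRogawski1991, §3.1 Remark p. 457 L4–13] -/
theorem exists_holReal_of_transport :
    ∃ θ : Ω →ₗ[ℂ] ((adelicDatum F V).Adelic → (Fin 2 → ℂ)),
      θ ≠ 0 ∧ (∀ v, θ v ∈ holCotForms (archFactorOf F V)) ∧
        ∀ (g : ↥(HodgeCM.HermSpace3.adelicFin V)) (v : Ω), θ (ρ g v) = rightRep F V g (θ v) := by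
  obtain ⟨θD, hmk, hrep, hhol, hzero⟩ := exists_coinvLift_dist F V hV D hι hΓ hGfin hLF hd hCR χ
  -- the model's two members commute; the transport of the coinvariants along `T`
  have hcD := commute_ωf_inl_inr F V hV D
  let M := Literature.RepresentationTheory.TwistedCoinv.mapEquiv ρW₁ χ₁ (D.ωf.comp (MonoidHom.inr _ _)) (D.chiFin χ) T e hT hχ
  refine ⟨θD ∘ₗ M.toLinearMap ∘ₗ Ψ.toLinearMap, ?_, fun v => hhol _, fun g v => ?_⟩
  · -- non-vanishing: `θD ≠ 0` and `M ∘ Ψ` is onto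
    obtain ⟨Φf, hΦf⟩ := hne
    intro h0
    apply hΦf
    have hsurj : Function.Surjective (M.toLinearMap ∘ₗ Ψ.toLinearMap) := fun y => ⟨Ψ.symm (M.symm y), by simp⟩
    have hθD : θD = 0 := by
      refine LinearMap.ext fun y => ?_
      obtain ⟨x, rfl⟩ := hsurj y
      have := LinearMap.congr_fun h0 x
      simpa only [LinearMap.comp_apply, LinearMap.zero_apply] using this
    exact (hzero.1 hθD) Φf
  · -- equivariance on the nose: the two `λ g` cancel
    have hM : ∀ x, Literature.RepresentationTheory.TwistedCoinv.rep (D.chiFin χ) (D.ωf.comp (MonoidHom.inl _ _)) hcD g (M x) =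
        ((lam g : ℂˣ) : ℂ) • M (Literature.RepresentationTheory.TwistedCoinv.rep χ₁ ρV₁ hc₁ g x) := fun x =>
      Literature.RepresentationTheory.TwistedCoinv.mapEquiv_rep ρW₁ χ₁ (D.ωf.comp (MonoidHom.inr _ _)) (D.chiFin χ) ρV₁
        (D.ωf.comp (MonoidHom.inl _ _)) hc₁ hcD T e hT hχ (hTV g) x
    have hM' : ∀ x, M (Literature.RepresentationTheory.TwistedCoinv.rep χ₁ ρV₁ hc₁ g x) =
        (((lam g)⁻¹ : ℂˣ) : ℂ) • Literature.RepresentationTheory.TwistedCoinv.rep (D.chiFin χ) (D.ωf.comp (MonoidHom.inl _ _)) hcD g (M x) :=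
      fun x => by rw [hM x, smul_smul, Units.inv_mul, one_smul]
    show θD (M (Ψ (ρ g v))) = rightRep F V g (θD (M (Ψ v)))
    rw [hΨ, map_smul, hM', smul_smul, Units.mul_inv, one_smul, hrep]

end Generic

/-! ## At the degenerate seesaw context `cDiag a` (★ `Theorems/H413ThetaDistAtLine`) -/

section AtLine

open Summit.HodgeConjecture.HodgeConjecture.Cruxes.H413.ThetaDistAtLine

variable (Φ : CMType (F : Type)) (σ : (F : Type) →+* ℂ) (a : (F : Type)) (ha : IsCMField.complexConj (F : Type) a = a) (ha0 : a ≠ 0)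
variable (η : CMAdelic (F : Type) (frameD V) × CMAdelic (F : Type) (dW (cDiag Φ σ a ha ha0).D) →* ℂˣ)
  (hη : ∀ γU ∈ CMRat (F : Type) (frameD V), ∀ γ ∈ CMRat (F : Type) (dW (cDiag Φ σ a ha ha0).D), η (γU, γ) = 1)
  (hηc : Continuous fun p => ((η p : ℂˣ) : ℂ))
  (ν : CMAdelic (F : Type) (frameD V) →* ℂˣ)
  (hν : ∀ γU ∈ CMRat (F : Type) (frameD V), ν γU = 1)
  (hνc : Continuous fun v => ((ν v : ℂˣ) : ℂ))
  (A : ∀ k : Fin 4, ArchLineInput V (lineRepT V (cDiag Φ σ a ha ha0).D (compat_plane V Φ σ a ha ha0) (compat_line₀ V Φ σ a ha ha0)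
    (compat_line₁ V Φ σ a ha ha0) (compat_line₂ V Φ σ a ha ha0) (compat_line₃ V Φ σ a ha ha0) η ν k))
  (D : (sideAt V Φ σ a ha ha0 η hη hηc ν hν hνc A).ThetaDistDatum hV 0)
  (hLF : ((sideAt V Φ σ a ha ha0 η hη hηc ν hν hνc A).P 0).IsLFAction)
  (hd : ∀ (T : 𝓢((Fin 3 → mixedSpace (↥(maximalRealSubfield F))), ℂ) →L[ℂ] ℂ) (ℓ : Module.Dual ℂ (Fin 2 → ℂ)),
    DifferentiableAt ℝ (fun b => T (D.ωA (BallForms.expP b) (D.Φarch ℓ))) 0)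
  (hCR : ∀ (T : 𝓢((Fin 3 → mixedSpace (↥(maximalRealSubfield F))), ℂ) →L[ℂ] ℂ) (ℓ : Module.Dual ℂ (Fin 2 → ℂ)) (v : Fin 2 → ℂ),
    fderiv ℝ (fun b => T (D.ωA (BallForms.expP b) (D.Φarch ℓ))) 0 (Complex.I • v) =
      Complex.I • fderiv ℝ (fun b => T (D.ωA (BallForms.expP b) (D.Φarch ℓ))) 0 v)
  (χ : PontryaginDual (↥(Literature.NumberTheory.Automorphic.relNormOneIdeles (↥(maximalRealSubfield F)) F) ⧸
      Literature.NumberTheory.Automorphic.relNormOneRat (↥(maximalRealSubfield F)) F))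

variable {Ω : Type} [AddCommGroup Ω] [Module ℂ Ω] (ρ : Representation ℂ ↥(HodgeCM.HermSpace3.adelicFin V) Ω)
  {S₁ : Type} [AddCommGroup S₁] [Module ℂ S₁] (ρV₁ : Representation ℂ ↥(HodgeCM.HermSpace3.adelicFin V) S₁)
  (ρW₁ : Representation ℂ D.Uf S₁) (hc₁ : ∀ (g : ↥(HodgeCM.HermSpace3.adelicFin V)) (u : D.Uf), Commute (ρV₁ g) (ρW₁ u))
  (χ₁ : D.Uf →* ℂˣ) (lam : ↥(HodgeCM.HermSpace3.adelicFin V) → ℂˣ)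
  (Ψ : Ω ≃ₗ[ℂ] Literature.RepresentationTheory.TwistedCoinv.Coinv ρW₁ χ₁)
  (hΨ : ∀ (g : ↥(HodgeCM.HermSpace3.adelicFin V)) (x : Ω),
    Ψ (ρ g x) = ((lam g : ℂˣ) : ℂ) • Literature.RepresentationTheory.TwistedCoinv.rep χ₁ ρV₁ hc₁ g (Ψ x))
  (T : S₁ ≃ₗ[ℂ] FinSB (↥(maximalRealSubfield F)) (Fin 3)) (e : D.Uf → ℂˣ)
  (hT : ∀ (u : D.Uf) (v : S₁), D.ωf.comp (MonoidHom.inr _ _) u (T v) = ((e u : ℂˣ) : ℂ) • T (ρW₁ u v))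
  (hχ : ∀ u : D.Uf, D.chiFin χ u = e u * χ₁ u)
  (hTV : ∀ (g : ↥(HodgeCM.HermSpace3.adelicFin V)) (v : S₁), D.ωf.comp (MonoidHom.inl _ _) g (T v) = ((lam g : ℂˣ) : ℂ) • T (ρV₁ g v))
  (hne : ∃ Φf : FinSB (↥(maximalRealSubfield F)) (Fin 3), D.dist (charInv χ) Φf ≠ 0)

include hLF hd hCR hΨ hT hχ hTV hne in
/-- **`HolReal` from a transport, at the line `a`** (the instance of `exists_holReal_of_transport` over ★ `ThetaDistAtLine.sideAt`; the two `rfl`s and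
`sat(K) ≤ archFinOf V` discharged). [cite: Liu2021, proof of Prop. 4.13, l. 2145; App. D §D.1 Step 3 (l. 5219–5221)] -/
theorem exists_holReal_of_transport_sideAt :
    ∃ θ : Ω →ₗ[ℂ] ((adelicDatum F V).Adelic → (Fin 2 → ℂ)),
      θ ≠ 0 ∧ (∀ v, θ v ∈ holCotForms (archFactorOf F V)) ∧
        ∀ (g : ↥(HodgeCM.HermSpace3.adelicFin V)) (v : Ω), θ (ρ g v) = rightRep F V g (θ v) :=
  exists_holReal_of_transport F V hV D (sideAt_ιinf V Φ σ a ha ha0 η hη hηc ν hν hνc A)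
    (sideAt_P_ΓU V Φ σ a ha ha0 η hη hηc ν hν hνc A 0) (satG_le_sideAt_Gfin F V hV Φ σ a ha ha0 η hη hηc ν hν hνc A) hLF hd hCR χ
    ρ ρV₁ ρW₁ hc₁ χ₁ lam Ψ hΨ T e hT hχ hTV hne

end AtLine

end Summit.HodgeConjecture.HodgeConjecture.Cruxes.H413.ThetaJunction

end
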